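import Literature.MathematicalPhysics.QuantumFieldTheory.Balaban1983to89.Node00.OpsYRecordV4
import Literature.MathematicalPhysics.QuantumFieldTheory.Balaban1983to89.B9Thm315WholeBlocks

/-!
# `Balaban1983to89.B9Thm315WholeSectERep` — [B9] Theorem 3.15 (p. 432), «The formula (3.185) implies immediately bounds and an exponential
# decay»: ROW 24 (`t315`) of the N06 certificate AT THE SECT. E LAYER with the bound (3.187) PROVED FROM THE PINNED (3.185) IDENTITY
# `Node00.givenBy3185Y`, located locality of the outer factors `P_Λ(I + Dμ)P_Λ`, `P_Λ(I + μ*D*)P_Λ` and the located decay of `QG̃₂Q*`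

T. Bałaban, *Propagators for lattice gauge theories in a background field*, Commun. Math. Phys. **99** (1985) 389–434
[`Balaban1985BackgroundPropagators`, "B9"].

statement-level skeleton of published theorems with citation tags; proofs where landed; nothing here is a claim about the Yang–Mills mass gap

THE PRINTED LOCUS (verbatim, p. 432 [PDF 44]).  *"Let us denote a covariance operator of the Gaussian integral in (3.183) by G̃₂, then we
obtain C^{(k)}(Λ) = (I + Dμ)QG̃₂Q*(I + μ*D*). (3.185)  It is the formula we are looking for. … G̃₂ = G₂ − G₂Q̃*(Q̃G₂Q̃*)⁻¹Q̃G₂. (3.186) … Expanding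
these into random walks we get a random walk expansion of C^{(k)}(Λ). The formula (3.185) implies immediately bounds and an exponential decay. Thus
we get Theorem 3.15.  For Mα₀ sufficiently small the propagator C^{(k)}(Λ) is given by the formula (3.185), and satisfies the bound |C^{(k)}(Λ; y, y′)|
≤ B₀e^{−δ₀|y−y′|}, y, y′ ∈ Λ (3.187) with the constants B₀, δ₀ depending on d and L only."*  p. 430, (3.169): *"μ(y) = Q′(R_y(V)B)(Γ_{y,·}), μ(x) =
R(V(Γ_{x,y}))Q′(R_y(V)B)(Γ_{y,·}) − R(V(Γ_{x,y}))(R_y(V)B)(Γ_{y,x}), x ∈ B(y), x ≠ y. (3.169) We denote the linear function defined by the above formulas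
by μ(B)."* (a LOCAL function of B: `μ(B)(x)` reads `B` on the contour `Γ_{y,x}` and on the block `B(y)` only; `D = D_V` is the one-step covariant
derivative).

THE POINT.  def-Y's `Node00.OpsYSectE` (p498175) pins row 24's first slot as the EQUATION `givenBy3185Y x 𝔏 𝔢 U : CkY x 𝔏 𝔢 U = rhs3185Y x 𝔏 𝔢 U`
between the letter `C^{(k)}(Λ; U)` DEFINED by (3.156)–(3.158) and the (3.185) expression `P_Λ(1 + Dμ)P_Λ · QG̃₂Q* · P_Λ(1 + μ*D*)P_Λ` over the
residual Sect. E letters `𝔢`.  The seat's `B9Thm315WholeSectE` (p501218) proves the bound (3.187) through the OTHER slot (the walk expansion).  THIS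
FILE proves it through the (3.185) slot — print's own sentence *"The formula (3.185) implies immediately bounds and an exponential decay"*: the
kernel of a product `E·S·F` of block matrices whose outer factors have range `r` and row ∕ column mass `m_E, m_F` along `|y − y′|` and whose middle
factor decays like `B₁e^{−δ₁|y−y′|}` decays like `B₁e^{2δ₁r}m_Em_F·e^{−δ₁|y−y′|}` (`B9Thm315Decay.dressed_decay` on the norm-majorant matrices).  The
blocks are those of the seat's generic block calculus `B9Thm315WholeBlocks` §2 (`blockCLM ∕ blockMat ∕ abs_iSup_ball_le_norm_blockCLM ∕ blockMat_comp`,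
generic in the index — here the index IS the index-bond carrier, placing `π = id`, so def-Y's reading `siteKernelOfOp … id id` is dominated with
constant `K = 1`).  What stays displayed is print-shaped and about def-Y's letters: the (3.185) identity on the printed prefix (G-B9-09∕17), the
locality of the two outer factors (`LocalOuterY` — (3.169); dischargeable by computation once def-Y constructs the Sect. E letters of record,
(M-E1)), the decay of the blocks of `QG̃₂Q*` (`DecayMidY` — (3.186) with the Sect. C expansions of `G₂`, `(Q̃G₂Q̃*)⁻¹`, GAPS G-B9-10), and the
expansion slot `hasRWExpCY` (passed through, as the typed sentence lists it).

* §1 (generic finite index `P`, real normed ring `𝔸′`) `norm_mul₃_apply_le` (‖(ESF)(p,q)‖ ≤ (|E|·|S|·|F|)(p,q) for the norm-majorant matrices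
  `B9Eq3187Op.nrm`), ★ `op_dressed_decay` (range `r` + row mass `m_E` of `E`, range `r` + column mass `m_F` of `F`, decay `B₁e^{−δ₁ρ}` of `S` along a
  pseudo-distance `ρ` ⇒ ‖(ESF)(p,q)‖ ≤ B₁e^{2δ₁r}m_Em_F·e^{−δ₁ρ(p,q)}`).
* §2 (at a member, `[FiniteDimensional ℂ 𝔸]` — automatic at `M_N(ℂ)`) the three factors of def-Y's `rhs3185Y`: `outerLY` (`P_Λ(1 + Dμ)P_Λ`), `midSY`
  (`Q(U)G̃₂(U)Q*(U)`), `outerRY` (`P_Λ(1 + μ*D*)P_Λ`), `rhs3185Y_eq_mul` (`rfl`); `blockMat_mul`; ★ `blockMat_CkY_of_givenBy3185Y` (the pinned identity ⇒ the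
  block identity `blockMat C^{(k)} = blockMat E · blockMat S · blockMat F`); ★ `abs_ker_CkY_le` (def-Y's kernel entry `sup_{‖E‖≤1}‖(C^{(k)}(Λ;U)(δ_{y′} ⊗ E))(y)‖`
  is at most the operator norm of the `(y, y′)` block); the located schemas `LocalOuterY x 𝔢 r m_E m_F` and `DecayMidY x 𝔏 𝔢 B₁ U δ`; ★ `bound3187_sectE_of_3185`
  (ONE configuration: (3.185) + locality + decay ⇒ |C^{(k)}(Λ; U; y, y′)| ≤ B₁e^{2δr}m_Em_F·e^{−δ|y−y′|} for ALL index bonds `y, y′`).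
* §3 ★★ `thm315FullPrinted_sectE_of_3185` — `B9.Thm315FullPrinted` AT `operatorLayerYSectE 𝔸 G x (ops x) (𝔏 x) (𝔢 x) (𝔴 x)` from `h` = on the printed
  prefix `givenBy3185Y ∧ hasRWExpCY (𝔴 x) U δ₁ ∧ LocalOuterY x (𝔢 x) r m_E m_F U ∧ DecayMidY x (𝔏 x) (𝔢 x) B₁ U δ₁`; OUTPUT δ₀ = δ₁, a₀, B₀ =
  B₁e^{2δ₁r}m_Em_F; `thm315Printed_sectE_of_3185`.  §4 record level ★★ `t315_opsYSectE_of_3185` (generic `ops 𝔏 𝔢 𝔴`), ★★ `t315_opsYOfRecordES_of_3185`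
  (the binder `t315` VERBATIM at `ops := Node00.opsYOfRecordES N θ M⋆ 𝔯 𝔢 𝔴 𝔈`), ★★ `t315_opsYOfRecordV4E_of_3185` (the same at def-Y's v4 instance of
  record `Node00.opsYOfRecordV4E N θ M⋆ 𝔯 𝔢 𝔴 𝔈`, `Node00.OpsYRecordV4` p500763 — symmetrised transporters).

HONEST SCOPE.  Count-neutral kernel bookkeeping: a finite-dimensional sandwich estimate and the block dictionary; the (3.185) identity, the decay of
`QG̃₂Q*`, the locality constants and the expansion clause stay DISPLAYED hypotheses on def-Y's residual letters.  Nothing of print is asserted; NOT a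
node discharge (N06 unmoved), NOT summit progress; one finite lattice programme at fixed ε; nothing continuum ∕ ℝ⁴ ∕ OS ∕ mass gap ∕ Clay.  Cell
`pub-ymgap` (D-0062), node N06 [B9], N06-ASSIGNMENT bundle F8 row 24 (successor file), seat `pub-ymgap-dag-n06-m` (g4), 2026-08-27.  Imports def-Y's
`Node00.OpsYRecordV4` (hence `Node00.OpsYSectE`) and the seat's `B9Thm315WholeBlocks` (hence `B9Eq3187Op`, `B9Thm315Decay`, `B9Thm314WholePinGeometry`);
nothing of them is restated.
Net new unproved facts: 0.
-/

noncomputable section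

namespace Literature.MathematicalPhysics.QuantumFieldTheory.Balaban1983to89.B9Thm315WholeSectERep

open B9 Node00
open B4Sect5Torus (IsPseudoDist)
open B6KLevelCensusIndexV1 (KIdx)
open B9PinMembersKLevelV1 (MemberY geo9Y bg9Y)
open B9PinCarriersKLevelV1 (OperatorLayerY)
open B9PinGeometryKLevelV1 (inΛY unitDistY c35Y)
open B7Prop2SpecialUnitary (specialUnitaryUnits)
open B9Eq3187Op (nrm nrm_apply)
open B9Thm315WholeBlocks (blockCLM blockMat blockMat_apply blockCLM_apply abs_iSup_ball_le_norm_blockCLM blockMat_comp)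
open B9Thm314WholePinGeometry (isPseudoDist_unitDistY)
open scoped Matrix

/-! ## §1 The sandwich estimate for block matrices with separate locality data of the two outer factors -/

section Sandwich

variable {𝔸' : Type} [NormedRing 𝔸'] {P : Type} [Fintype P]

/-- **THE NORM MAJORANT OF A TRIPLE PRODUCT**: `‖(E·S·F)(p, q)‖ ≤ (|E|·|S|·|F|)(p, q)` entrywise for the real matrices of block norms
(`B9Eq3187Op.nrm`; triangle inequality and submultiplicativity). [cite: Balaban1985BackgroundPropagators, (3.185) p.432, bookkeeping] -/
theorem norm_mul₃_apply_le (E S F : Matrix P P 𝔸') (p q : P) : ‖(E * S * F) p q‖ ≤ (nrm E * nrm S * nrm F) p q := by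
  simp only [Matrix.mul_apply, nrm_apply]
  refine (norm_sum_le _ _).trans (Finset.sum_le_sum fun q' _ => ?_)
  refine (norm_mul_le _ _).trans ?_
  exact mul_le_mul_of_nonneg_right ((norm_sum_le _ _).trans (Finset.sum_le_sum fun p' _ => norm_mul_le _ _)) (norm_nonneg _)

/-- ★ **«THE FORMULA (3.185) IMPLIES IMMEDIATELY BOUNDS AND AN EXPONENTIAL DECAY» for block matrices over any real normed ring**: if the middle factor
decays, `‖S(p, q)‖ ≤ B₁e^{−δ₁ρ(p,q)}` along a pseudo-distance `ρ`, the left factor has range `≤ r` and row mass `Σ_q ‖E(p, q)‖ ≤ m_E`, and the right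
factor has range `≤ r` and column mass `Σ_q ‖F(q, p)‖ ≤ m_F`, then `‖(E·S·F)(p, q)‖ ≤ B₁e^{2δ₁r}m_Em_F·e^{−δ₁ρ(p,q)}` — `B9Thm315Decay.dressed_decay` on
the norm majorants. [cite: Balaban1985BackgroundPropagators, Thm 3.15 (3.185)–(3.187) p.432] -/
theorem op_dressed_decay (ρ : P → P → ℝ) (hρ : IsPseudoDist ρ) (E S F : Matrix P P 𝔸') {B₁ δ₁ r mE mF : ℝ} (hB₁ : 0 ≤ B₁) (hδ₁ : 0 ≤ δ₁)
    (hS : ∀ p q, ‖S p q‖ ≤ B₁ * Real.exp (-(δ₁ * ρ p q)))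
    (hEr : ∀ p q, E p q ≠ 0 → ρ p q ≤ r) (hE1 : ∀ p, ∑ q, ‖E p q‖ ≤ mE)
    (hFr : ∀ q p, F q p ≠ 0 → ρ q p ≤ r) (hF1 : ∀ p, ∑ q, ‖F q p‖ ≤ mF) (p q : P) :
    ‖(E * S * F) p q‖ ≤ B₁ * Real.exp (2 * δ₁ * r) * mE * mF * Real.exp (-(δ₁ * ρ p q)) := by
  refine (norm_mul₃_apply_le E S F p q).trans ((le_abs_self _).trans ?_)
  refine B9Thm315Decay.dressed_decay ρ hρ (nrm E) (nrm S) (nrm F) hB₁ hδ₁ ?_ ?_ ?_ ?_ ?_ p q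
  · intro u v
    rw [nrm_apply, abs_norm]
    exact hS u v
  · intro p' u h
    exact hEr p' u fun h0 => h (by rw [nrm_apply, h0, norm_zero])
  · intro p'
    simp only [nrm_apply, abs_norm]
    exact hE1 p'
  · intro v q' h
    exact hFr v q' fun h0 => h (by rw [nrm_apply, h0, norm_zero])
  · intro q'
    simp only [nrm_apply, abs_norm]
    exact hF1 q'

end Sandwich

/-! ## §2 The three factors of (3.185) at the Sect. E layer, their blocks, the located locality ∕ decay, and (3.185) ⇒ (3.187) at one configuration -/

section Factors

variable {d ℓ : ℕ} {hd : 1 ≤ d + 1} {hL : Odd (ℓ + 1) ∧ 1 < ℓ + 1} {b₀ b₁ : ℝ} {Mstar : ℕ}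
variable {𝔸 : Type} [NormedRing 𝔸] [NormedAlgebra ℂ 𝔸] [CompleteSpace 𝔸]
variable (x : MemberY d ℓ hd hL b₀ b₁ Mstar) (𝔏 : CovLettersY 𝔸 x) (𝔢 : SectELettersY 𝔸 x)

/-- **the left factor of (3.185)** `P_Λ(1 + Dμ)P_Λ` as a letter on the index-bond functions (def-Y's `rhs3185Y`, first factor).
[cite: Balaban1985BackgroundPropagators, (3.185) p.432, (3.169) p.430] -/
def outerLY : IBondOpY 𝔸 x.toKIdx := fun U => secΛY 𝔸 x * (1 + 𝔢.Dbar U ∘ₗ 𝔢.mu U) * secΛY 𝔸 x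

/-- **the middle factor of (3.185)** `Q(U)G̃₂(U)Q*(U)` (def-Y's genuine `QY ∕ QsY` over the record's transporter, the letter `G̃₂` of (3.186)).
[cite: Balaban1985BackgroundPropagators, (3.185)–(3.186) p.432] -/
def midSY : IBondOpY 𝔸 x.toKIdx := fun U => QY x.toKIdx 𝔏.parB U ∘ₗ 𝔢.Gt2 U ∘ₗ QsY x.toKIdx 𝔏.parB U

/-- **the right factor of (3.185)** `P_Λ(1 + μ*D*)P_Λ`. [cite: Balaban1985BackgroundPropagators, (3.185) p.432, (3.169) p.430] -/
def outerRY : IBondOpY 𝔸 x.toKIdx := fun U => secΛY 𝔸 x * (1 + 𝔢.muT U ∘ₗ 𝔢.DbarT U) * secΛY 𝔸 x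

variable {x 𝔏 𝔢}

/-- def-Y's (3.185) expression IS the product of the three factors (`rfl`). [cite: Balaban1985BackgroundPropagators, (3.185) p.432, bookkeeping] -/
theorem rhs3185Y_eq_mul (U : CfgY 𝔸 x.toKIdx) : rhs3185Y x 𝔏 𝔢 U = outerLY x 𝔢 U * midSY x 𝔏 𝔢 U * outerRY x 𝔢 U := rfl

variable [FiniteDimensional ℂ 𝔸]

omit [CompleteSpace 𝔸] in
/-- blocks of a product of two letters: `blockMat (A·B) = blockMat A · blockMat B` (the seat's `blockMat_comp`). [cite: Balaban1985BackgroundPropagators, (3.185) p.432, bookkeeping] -/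
theorem blockMat_mul {X : Type} [Fintype X] (A B : Module.End ℂ (X → 𝔸)) : blockMat (A * B) = blockMat A * blockMat B := by
  rw [Module.End.mul_eq_comp]
  exact blockMat_comp A B

/-- ★ **THE PINNED (3.185) IDENTITY GIVES THE BLOCK IDENTITY**: `givenBy3185Y x 𝔏 𝔢 U` ⇒ `blockMat C^{(k)}(Λ; U) = blockMat(P_Λ(1 + Dμ)P_Λ) ·
blockMat(QG̃₂Q*) · blockMat(P_Λ(1 + μ*D*)P_Λ)` over the index bonds, entries in `𝔸 →L[ℂ] 𝔸`. [cite: Balaban1985BackgroundPropagators, Thm 3.15 (3.185) p.432] -/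
theorem blockMat_CkY_of_givenBy3185Y {U : CfgY 𝔸 x.toKIdx} (h : givenBy3185Y x 𝔏 𝔢 U) :
    blockMat (CkY x 𝔏 𝔢 U) = blockMat (outerLY x 𝔢 U) * blockMat (midSY x 𝔏 𝔢 U) * blockMat (outerRY x 𝔢 U) := by
  rw [(givenBy3185Y_iff U).1 h, rhs3185Y_eq_mul, blockMat_mul, blockMat_mul]

variable (x 𝔏 𝔢) {G : Subgroup 𝔸ˣ}

/-- ★ **def-Y's KERNEL ENTRY IS DOMINATED BY THE BLOCK NORM** (placing `π = id`, constant `K = 1`): `|C^{(k)}(Λ; U; y, y′)| = sup_{‖E‖≤1}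
‖(C^{(k)}(Λ; U)(δ_{y′} ⊗ E))(y)‖ ≤ ‖blockMat C^{(k)}(Λ; U) (y, y′)‖` (the seat's `abs_iSup_ball_le_norm_blockCLM`). [cite: Balaban1985BackgroundPropagators, Thm 3.15 (3.187) p.432, p.390 (block norm)] -/
theorem abs_ker_CkY_le (U : (bg9Y 𝔸 G x).Cfg) (y y' : (geo9Y x).Site) :
    |(siteKernelOfOp x.toKIdx (bg9Y 𝔸 G x) (fun U => U) (CkY x 𝔏 𝔢) id id).ker U y y'| ≤ ‖blockMat (CkY x 𝔏 𝔢 U) y y'‖ :=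
  abs_iSup_ball_le_norm_blockCLM (CkY x 𝔏 𝔢 U) y y'

/-- ★ **THE LOCATED LOCALITY OF THE TWO OUTER FACTORS OF (3.185) AT A CONFIGURATION `U`** along `|y − y′| = unitDistY` ((3.169): `μ(B)(x)` reads `B`
on the contour `Γ_{y,x}` and the block `B(y)`, `D = D_V` is one-step, `P_Λ` restricts to Λ; `V = U_k` is `G`-valued for `U` in the classes (3.35)–(3.36),
so the transports `R(V(Γ))` are isometric): the `(p, q)` block of `P_Λ(1 + Dμ)P_Λ` (the seat's `blockCLM`, index = the index bonds, placing `id`)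
vanishes unless `|p − q| ≤ r` and its rows have operator-norm mass `Σ_q ‖block(p, q)‖ ≤ m_E`; the `(q, p)` block of `P_Λ(1 + μ*D*)P_Λ` vanishes unless
`|q − p| ≤ r` and its columns have mass `Σ_q ‖block(q, p)‖ ≤ m_F` («constants depending on d and L only»).  Stated PER `U` (the family theorem displays it
under the printed prefix, where `U` is `G`-valued and regular); a hypothesis schema on def-Y's residual Sect. E letters — a finite computation once they
are constructed ((M-E1) of `Node00.OpsYSectE`, def-Y g5's announced `sectEYOfRecord`); nothing asserted.
[cite: Balaban1985BackgroundPropagators, (3.169) p.430, (3.185) p.432] -/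
structure LocalOuterY (r mE mF : ℝ) (U : CfgY 𝔸 x.toKIdx) : Prop where
  rangeL : ∀ p q : IBondY x.toKIdx, blockCLM (outerLY x 𝔢 U) p q ≠ 0 → unitDistY x p q ≤ r
  rowMassL : ∀ p : IBondY x.toKIdx, ∑ q, ‖blockCLM (outerLY x 𝔢 U) p q‖ ≤ mE
  rangeR : ∀ q p : IBondY x.toKIdx, blockCLM (outerRY x 𝔢 U) q p ≠ 0 → unitDistY x q p ≤ r
  colMassR : ∀ p : IBondY x.toKIdx, ∑ q, ‖blockCLM (outerRY x 𝔢 U) q p‖ ≤ mF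

/-- ★ **THE LOCATED DECAY OF THE MIDDLE FACTOR `QG̃₂Q*` AT `(U, δ)`**: `‖blockMat(Q(U)G̃₂(U)Q*(U))(p, q)‖ ≤ B₁e^{−δ|p−q|}` along `unitDistY` (print:
(3.186) and the random walk expansions of `G₂`, `(Q̃G₂Q̃*)⁻¹` for the extended sequence, p. 432 — GAPS G-B9-10).  A hypothesis schema; nothing asserted.
[cite: Balaban1985BackgroundPropagators, (3.186) p.432, Thm 3.7 (3.90) p.409, Thm 3.9 (3.98) p.413] -/
def DecayMidY (B₁ : ℝ) (U : CfgY 𝔸 x.toKIdx) (δ : ℝ) : Prop :=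
  ∀ p q : IBondY x.toKIdx, ‖blockCLM (midSY x 𝔏 𝔢 U) p q‖ ≤ B₁ * Real.exp (-(δ * unitDistY x p q))

variable {x 𝔏 𝔢}

/-- the decay schema unfolded. [cite: Balaban1985BackgroundPropagators, (3.186) p.432, bookkeeping] -/
theorem decayMidY_iff (B₁ : ℝ) (U : CfgY 𝔸 x.toKIdx) (δ : ℝ) :
    DecayMidY x 𝔏 𝔢 B₁ U δ ↔ ∀ p q : IBondY x.toKIdx, ‖blockCLM (midSY x 𝔏 𝔢 U) p q‖ ≤ B₁ * Real.exp (-(δ * unitDistY x p q)) := Iff.rfl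

/-- **the locality schema from def-Y's phrasing** («`r < |p − q| ⇒ block = 0`» and the two mass bounds): the range clauses of `LocalOuterY` are the
contrapositives. [cite: Balaban1985BackgroundPropagators, (3.169) p.430, bookkeeping] -/
theorem localOuterY_of_vanish {r mE mF : ℝ} {U : CfgY 𝔸 x.toKIdx}
    (hL0 : ∀ p q : IBondY x.toKIdx, r < unitDistY x p q → blockCLM (outerLY x 𝔢 U) p q = 0)
    (hLm : ∀ p : IBondY x.toKIdx, ∑ q, ‖blockCLM (outerLY x 𝔢 U) p q‖ ≤ mE)
    (hR0 : ∀ q p : IBondY x.toKIdx, r < unitDistY x q p → blockCLM (outerRY x 𝔢 U) q p = 0)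
    (hRm : ∀ p : IBondY x.toKIdx, ∑ q, ‖blockCLM (outerRY x 𝔢 U) q p‖ ≤ mF) : LocalOuterY x 𝔢 r mE mF U :=
  ⟨fun p q h => not_lt.1 fun hlt => h (hL0 p q hlt), hLm, fun q p h => not_lt.1 fun hlt => h (hR0 q p hlt), hRm⟩

omit [CompleteSpace 𝔸] in
/-- the blocks of both outer factors VANISH OFF Λ × Λ for ANY letters (the two `P_Λ`): only pairs of bonds of Λ carry locality content.
[cite: Balaban1985BackgroundPropagators, p.427 («g … defined at bonds of Λ»), (3.185) p.432, bookkeeping] -/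
theorem blockCLM_sandwich_eq_zero (T : Module.End ℂ (IBondY x.toKIdx → 𝔸)) {p q : IBondY x.toKIdx} (h : ¬ (inΛY x p ∧ inΛY x q)) :
    blockCLM (secΛY 𝔸 x * T * secΛY 𝔸 x) p q = 0 := by
  ext a
  rw [blockCLM_apply, zero_apply, Module.End.mul_apply, Module.End.mul_apply]
  by_cases hq : inΛY x q
  · have hp : ¬ inΛY x p := fun hp => h ⟨hp, hq⟩
    exact secY_apply_of_not hp _
  · have h0 : secΛY 𝔸 x (deltaY q a) = 0 := by
      funext z
      by_cases hz : inΛY x z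
      · rw [secΛY, secY_apply_of hz]
        have hzq : z ≠ q := fun hzq => hq (hzq ▸ hz)
        simp [deltaY, hzq]
      · exact secY_apply_of_not hz _
    rw [h0, map_zero, map_zero]
    rfl

/-- in particular the blocks of `P_Λ(1 + Dμ)P_Λ` and `P_Λ(1 + μ*D*)P_Λ` vanish off Λ × Λ. [cite: Balaban1985BackgroundPropagators, (3.185) p.432, bookkeeping] -/
theorem blockCLM_outer_eq_zero_off (U : CfgY 𝔸 x.toKIdx) {p q : IBondY x.toKIdx} (h : ¬ (inΛY x p ∧ inΛY x q)) :
    blockCLM (outerLY x 𝔢 U) p q = 0 ∧ blockCLM (outerRY x 𝔢 U) p q = 0 :=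
  ⟨blockCLM_sandwich_eq_zero _ h, blockCLM_sandwich_eq_zero _ h⟩

/-- ★ **(3.185) ⇒ (3.187) AT ONE CONFIGURATION, AT THE SECT. E LAYER** (p. 432 *"The formula (3.185) implies immediately bounds and an exponential
decay"*): if `C^{(k)}(Λ; U)` is given by (3.185) (`givenBy3185Y`), the outer factors are local (`LocalOuterY … r m_E m_F`) and the blocks of `QG̃₂Q*(U)`
decay at `(B₁, δ)`, then def-Y's kernel satisfies `|C^{(k)}(Λ; U; y, y′)| ≤ B₁e^{2δr}m_Em_F·e^{−δ|y−y′|}` for ALL index bonds `y, y′`.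
[cite: Balaban1985BackgroundPropagators, Thm 3.15 (3.185)–(3.187) p.432, (3.169) p.430] -/
theorem bound3187_sectE_of_3185 {B₁ δ r mE mF : ℝ} (hB₁ : 0 ≤ B₁) (hδ : 0 ≤ δ) {U : (bg9Y 𝔸 G x).Cfg}
    (h85 : givenBy3185Y x 𝔏 𝔢 U) (hLoc : LocalOuterY x 𝔢 r mE mF U) (hS : DecayMidY x 𝔏 𝔢 B₁ U δ) (y y' : (geo9Y x).Site) :
    |(siteKernelOfOp x.toKIdx (bg9Y 𝔸 G x) (fun U => U) (CkY x 𝔏 𝔢) id id).ker U y y'| ≤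
      B₁ * Real.exp (2 * δ * r) * mE * mF * Real.exp (-(δ * unitDistY x y y')) := by
  refine (abs_ker_CkY_le x 𝔏 𝔢 U y y').trans ?_
  rw [blockMat_CkY_of_givenBy3185Y h85]
  exact op_dressed_decay (unitDistY x) (isPseudoDist_unitDistY x) _ _ _ hB₁ hδ (fun p q => hS p q)
    hLoc.rangeL hLoc.rowMassL hLoc.rangeR hLoc.colMassR y y'

end Factors

/-! ## §3 ROW 24 at the Sect. E layer `operatorLayerYSectE` through the (3.185) slot -/

section Layer

variable {d ℓ : ℕ} {hd : 1 ≤ d + 1} {hL : Odd (ℓ + 1) ∧ 1 < ℓ + 1} {b₀ b₁ : ℝ} {Mstar : ℕ}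
variable {𝔸 : Type} [NormedRing 𝔸] [NormedAlgebra ℂ 𝔸] [CompleteSpace 𝔸] [FiniteDimensional ℂ 𝔸] {G : Subgroup 𝔸ˣ}

/-- ★★ **THEOREM 3.15 AS THE WHOLE PRINTED LEAF `B9.Thm315FullPrinted` AT THE SECT. E LAYER, THE BOUND (3.187) PROVED THROUGH THE (3.185) SLOT**
(p. 432).  At every member the layer is def-Y's `operatorLayerYSectE 𝔸 G x (ops x) (𝔏 x) (𝔢 x) (𝔴 x)`.  DISPLAYED (`h`): under the printed prefix (every member,
`0 < α₀`, `Mα₀ ≤ a₀`, `U` in the classes (3.35)–(3.36)) the pinned (3.185) identity (print: (3.159)–(3.184) and the positivity of `C*Δ_kC`, p. 428;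
GAPS G-B9-09∕17), the pinned expansion clause at rate `δ₁` (passed through, as the typed sentence lists it), the locality of the two outer factors of
(3.185) at `U` (range `r`, masses `m_E`, `m_F` uniform in the member: «depending on d and L only»; (3.169)) and the decay of the blocks of `QG̃₂Q*(U)` at
`(B₁, δ₁)` (G-B9-10).  OUTPUT: `δ₀ = δ₁`, `a₀`, `B₀ = B₁e^{2δ₁r}m_Em_F`; the conjunct (3.187) is DERIVED (`bound3187_sectE_of_3185`).
Nothing of print asserted; NOT a node discharge. [cite: Balaban1985BackgroundPropagators, Thm 3.15 (3.185)–(3.187) p.432, (3.169) p.430, (3.186) p.432] -/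
theorem thm315FullPrinted_sectE_of_3185
    (ops : ∀ x : MemberY d ℓ hd hL b₀ b₁ Mstar, OperatorLayerY d ℓ hd hL b₀ b₁ Mstar 𝔸 G x)
    (𝔏 : ∀ x : MemberY d ℓ hd hL b₀ b₁ Mstar, CovLettersY 𝔸 x) (𝔢 : ∀ x : MemberY d ℓ hd hL b₀ b₁ Mstar, SectELettersY 𝔸 x)
    (𝔴 : ∀ x : MemberY d ℓ hd hL b₀ b₁ Mstar, RWLettersEY 𝔸 G x)
    {a₀ δ₁ B₁ r mE mF : ℝ} (ha₀ : 0 < a₀) (hδ₁ : 0 < δ₁) (hB₁ : 0 < B₁) (hmE : 0 < mE) (hmF : 0 < mF)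
    (h : ∀ (x : MemberY d ℓ hd hL b₀ b₁ Mstar) (α₀ : ℝ), 0 < α₀ → (geo9Y x).M * α₀ ≤ a₀ →
      ∀ U : (bg9Y 𝔸 G x).Cfg, (bg9Y 𝔸 G x).Reg335 c35Y α₀ U → (bg9Y 𝔸 G x).Reg336 c35Y α₀ U →
        givenBy3185Y x (𝔏 x) (𝔢 x) U ∧ hasRWExpCY (𝔴 x) U δ₁ ∧
          LocalOuterY x (𝔢 x) r mE mF U ∧ DecayMidY x (𝔏 x) (𝔢 x) B₁ U δ₁) :
    B9.Thm315FullPrinted c35Y geo9Y (bg9Y 𝔸 G)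
      (fun x => (operatorLayerYSectE 𝔸 G x (ops x) (𝔏 x) (𝔢 x) (𝔴 x)).Ck) inΛY unitDistY
      (fun x => (operatorLayerYSectE 𝔸 G x (ops x) (𝔏 x) (𝔢 x) (𝔴 x)).GivenBy3185)
      (fun x => (operatorLayerYSectE 𝔸 G x (ops x) (𝔏 x) (𝔢 x) (𝔴 x)).HasRWExpC) := by
  refine ⟨δ₁, a₀, B₁ * Real.exp (2 * δ₁ * r) * mE * mF, hδ₁, ha₀, by positivity, fun x α₀ hα hMa U hU hU' => ?_⟩
  obtain ⟨h85, hRW, hLoc, hS⟩ := h x α₀ hα hMa U hU hU'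
  exact ⟨h85, hRW, fun y y' _ _ => bound3187_sectE_of_3185 hB₁.le hδ₁.le h85 hLoc hS y y'⟩

/-- The bound-only leaf of unit r1 (`B9.Thm315Printed`, (3.187) alone) at the same data, by `B9.thm315_bound_of_full`.
[cite: Balaban1985BackgroundPropagators, Thm 3.15 (3.187) p.432] -/
theorem thm315Printed_sectE_of_3185
    (ops : ∀ x : MemberY d ℓ hd hL b₀ b₁ Mstar, OperatorLayerY d ℓ hd hL b₀ b₁ Mstar 𝔸 G x)
    (𝔏 : ∀ x : MemberY d ℓ hd hL b₀ b₁ Mstar, CovLettersY 𝔸 x) (𝔢 : ∀ x : MemberY d ℓ hd hL b₀ b₁ Mstar, SectELettersY 𝔸 x)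
    (𝔴 : ∀ x : MemberY d ℓ hd hL b₀ b₁ Mstar, RWLettersEY 𝔸 G x)
    {a₀ δ₁ B₁ r mE mF : ℝ} (ha₀ : 0 < a₀) (hδ₁ : 0 < δ₁) (hB₁ : 0 < B₁) (hmE : 0 < mE) (hmF : 0 < mF)
    (h : ∀ (x : MemberY d ℓ hd hL b₀ b₁ Mstar) (α₀ : ℝ), 0 < α₀ → (geo9Y x).M * α₀ ≤ a₀ →
      ∀ U : (bg9Y 𝔸 G x).Cfg, (bg9Y 𝔸 G x).Reg335 c35Y α₀ U → (bg9Y 𝔸 G x).Reg336 c35Y α₀ U →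
        givenBy3185Y x (𝔏 x) (𝔢 x) U ∧ hasRWExpCY (𝔴 x) U δ₁ ∧
          LocalOuterY x (𝔢 x) r mE mF U ∧ DecayMidY x (𝔏 x) (𝔢 x) B₁ U δ₁) :
    B9.Thm315Printed c35Y geo9Y (bg9Y 𝔸 G)
      (fun x => (operatorLayerYSectE 𝔸 G x (ops x) (𝔏 x) (𝔢 x) (𝔴 x)).Ck) inΛY unitDistY :=
  B9.thm315_bound_of_full c35Y geo9Y (bg9Y 𝔸 G) _ inΛY unitDistY _ _
    (thm315FullPrinted_sectE_of_3185 ops 𝔏 𝔢 𝔴 ha₀ hδ₁ hB₁ hmE hmF h)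

end Layer

/-! ## §4 Record level (`𝔸 = M_N(ℂ)`, `G = SU(N)`): ROW 24 through the (3.185) slot at `opsYSectE`, at `opsYOfRecordES` and at the v4 record `opsYOfRecordV4E` -/

section Record

open scoped Matrix.Norms.L2Operator

variable (N : ℕ) (θ : Stage3Params) (Mstar : ℕ)

/-- ★★ **ROW 24 (`t315`) OF THE N06 CERTIFICATE AT THE SECT. E LAYER FAMILY `opsYSectE N θ M⋆ ops 𝔏 𝔢 𝔴`, THROUGH THE (3.185) SLOT** (generic base
family `ops` and letters `𝔏`): §3 at `M_N(ℂ)`, `SU(N)` (finite dimension automatic).  Displayed: `h` as in `thm315FullPrinted_sectE_of_3185`.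
[cite: Balaban1985BackgroundPropagators, Thm 3.15 (3.185)–(3.187) p.432, (3.169) p.430, (3.186) p.432] -/
theorem t315_opsYSectE_of_3185 (ops : OpsY N θ Mstar) (𝔏 : LettersY N θ Mstar) (𝔢 : SectEY N θ Mstar) (𝔴 : RWEY N θ Mstar)
    {a₀ δ₁ B₁ r mE mF : ℝ} (ha₀ : 0 < a₀) (hδ₁ : 0 < δ₁) (hB₁ : 0 < B₁) (hmE : 0 < mE) (hmF : 0 < mF)
    (h : ∀ (x : MemberY θ.d₆ θ.ℓ₆ θ.hd' θ.hL' θ.b₀ θ.b₁ Mstar) (α₀ : ℝ), 0 < α₀ → (geo9Y x).M * α₀ ≤ a₀ →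
      ∀ U : (bg9Y (Matrix (Fin N) (Fin N) ℂ) (specialUnitaryUnits (Fin N)) x).Cfg,
        (bg9Y (Matrix (Fin N) (Fin N) ℂ) (specialUnitaryUnits (Fin N)) x).Reg335 c35Y α₀ U →
        (bg9Y (Matrix (Fin N) (Fin N) ℂ) (specialUnitaryUnits (Fin N)) x).Reg336 c35Y α₀ U →
          givenBy3185Y x (𝔏 x) (𝔢 x) U ∧ hasRWExpCY (𝔴 x) U δ₁ ∧
            LocalOuterY x (𝔢 x) r mE mF U ∧ DecayMidY x (𝔏 x) (𝔢 x) B₁ U δ₁) :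
    B9.Thm315FullPrinted c35Y geo9Y (bg9Y (Matrix (Fin N) (Fin N) ℂ) (specialUnitaryUnits (Fin N)))
      (fun x => (opsYSectE N θ Mstar ops 𝔏 𝔢 𝔴 x).Ck) inΛY unitDistY
      (fun x => (opsYSectE N θ Mstar ops 𝔏 𝔢 𝔴 x).GivenBy3185) (fun x => (opsYSectE N θ Mstar ops 𝔏 𝔢 𝔴 x).HasRWExpC) :=
  thm315FullPrinted_sectE_of_3185 ops 𝔏 𝔢 𝔴 ha₀ hδ₁ hB₁ hmE hmF h

/-- ★★ **ROW 24 (`t315`) OF THE N06 CERTIFICATE AT THE INSTANCE OF RECORD `opsYOfRecordES N θ M⋆ 𝔯 𝔢 𝔴 𝔈`, THROUGH THE (3.185) SLOT** — the binder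
VERBATIM (the left-hand side of def-Y's `t315_opsYOfRecordES_iff`), the bound (3.187) PROVED from the pinned identity + the outer locality + the decay
of `QG̃₂Q*`.  For dag-n06-d's E re-instantiation (alternative to `B9Thm315WholeSectE.t315_opsYOfRecordES_of_reading`: here the content flows through
the (3.185) slot, there through the expansion slot). [cite: Balaban1985BackgroundPropagators, Thm 3.15 (3.185)–(3.187) p.432, (3.169) p.430, (3.186) p.432] -/
theorem t315_opsYOfRecordES_of_3185 (𝔯 : ResY N θ Mstar) (𝔢 : SectEY N θ Mstar) (𝔴 : RWEY N θ Mstar) (𝔈 : ExpsY N θ Mstar)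
    {a₀ δ₁ B₁ r mE mF : ℝ} (ha₀ : 0 < a₀) (hδ₁ : 0 < δ₁) (hB₁ : 0 < B₁) (hmE : 0 < mE) (hmF : 0 < mF)
    (h : ∀ (x : MemberY θ.d₆ θ.ℓ₆ θ.hd' θ.hL' θ.b₀ θ.b₁ Mstar) (α₀ : ℝ), 0 < α₀ → (geo9Y x).M * α₀ ≤ a₀ →
      ∀ U : (bg9Y (Matrix (Fin N) (Fin N) ℂ) (specialUnitaryUnits (Fin N)) x).Cfg,
        (bg9Y (Matrix (Fin N) (Fin N) ℂ) (specialUnitaryUnits (Fin N)) x).Reg335 c35Y α₀ U →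
        (bg9Y (Matrix (Fin N) (Fin N) ℂ) (specialUnitaryUnits (Fin N)) x).Reg336 c35Y α₀ U →
          givenBy3185Y x (lettersYOfRecordDE N θ Mstar 𝔯 x) (𝔢 x) U ∧ hasRWExpCY (𝔴 x) U δ₁ ∧
            LocalOuterY x (𝔢 x) r mE mF U ∧ DecayMidY x (lettersYOfRecordDE N θ Mstar 𝔯 x) (𝔢 x) B₁ U δ₁) :
    B9.Thm315FullPrinted c35Y geo9Y (bg9Y (Matrix (Fin N) (Fin N) ℂ) (specialUnitaryUnits (Fin N)))
      (fun x => (opsYOfRecordES N θ Mstar 𝔯 𝔢 𝔴 𝔈 x).Ck) inΛY unitDistY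
      (fun x => (opsYOfRecordES N θ Mstar 𝔯 𝔢 𝔴 𝔈 x).GivenBy3185) (fun x => (opsYOfRecordES N θ Mstar 𝔯 𝔢 𝔴 𝔈 x).HasRWExpC) :=
  t315_opsYSectE_of_3185 N θ Mstar (B9Ineq349SiteReading.opsYS349OfRecordDE N θ Mstar 𝔯 𝔈) (lettersYOfRecordDE N θ Mstar 𝔯) 𝔢 𝔴
    ha₀ hδ₁ hB₁ hmE hmF h

/-- ★★ **ROW 24 (`t315`) OF THE N06 CERTIFICATE AT def-Y's v4 INSTANCE OF RECORD `opsYOfRecordV4E N θ M⋆ 𝔯 𝔢 𝔴 𝔈`** (symmetrised site transporters,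
`Node00.OpsYRecordV4`), THROUGH THE (3.185) SLOT — the binder VERBATIM (the left-hand side of def-Y's `t315_opsYOfRecordV4E_iff`), the bound (3.187)
PROVED; the letters the (3.185) identity and the decay schema read are `lettersYOfRecordV4 N θ M⋆ 𝔯 x`.
[cite: Balaban1985BackgroundPropagators, Thm 3.15 (3.185)–(3.187) p.432, (3.169) p.430, (3.186) p.432] -/
theorem t315_opsYOfRecordV4E_of_3185 (𝔯 : ResY N θ Mstar) (𝔢 : SectEY N θ Mstar) (𝔴 : RWEY N θ Mstar) (𝔈 : ExpsY N θ Mstar)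
    {a₀ δ₁ B₁ r mE mF : ℝ} (ha₀ : 0 < a₀) (hδ₁ : 0 < δ₁) (hB₁ : 0 < B₁) (hmE : 0 < mE) (hmF : 0 < mF)
    (h : ∀ (x : MemberY θ.d₆ θ.ℓ₆ θ.hd' θ.hL' θ.b₀ θ.b₁ Mstar) (α₀ : ℝ), 0 < α₀ → (geo9Y x).M * α₀ ≤ a₀ →
      ∀ U : (bg9Y (Matrix (Fin N) (Fin N) ℂ) (specialUnitaryUnits (Fin N)) x).Cfg,
        (bg9Y (Matrix (Fin N) (Fin N) ℂ) (specialUnitaryUnits (Fin N)) x).Reg335 c35Y α₀ U →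
        (bg9Y (Matrix (Fin N) (Fin N) ℂ) (specialUnitaryUnits (Fin N)) x).Reg336 c35Y α₀ U →
          givenBy3185Y x (lettersYOfRecordV4 N θ Mstar 𝔯 x) (𝔢 x) U ∧ hasRWExpCY (𝔴 x) U δ₁ ∧
            LocalOuterY x (𝔢 x) r mE mF U ∧ DecayMidY x (lettersYOfRecordV4 N θ Mstar 𝔯 x) (𝔢 x) B₁ U δ₁) :
    B9.Thm315FullPrinted c35Y geo9Y (bg9Y (Matrix (Fin N) (Fin N) ℂ) (specialUnitaryUnits (Fin N)))
      (fun x => (opsYOfRecordV4E N θ Mstar 𝔯 𝔢 𝔴 𝔈 x).Ck) inΛY unitDistY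
      (fun x => (opsYOfRecordV4E N θ Mstar 𝔯 𝔢 𝔴 𝔈 x).GivenBy3185) (fun x => (opsYOfRecordV4E N θ Mstar 𝔯 𝔢 𝔴 𝔈 x).HasRWExpC) :=
  t315_opsYSectE_of_3185 N θ Mstar (opsYS349OfRecordV4 N θ Mstar 𝔯 𝔈) (lettersYOfRecordV4 N θ Mstar 𝔯) 𝔢 𝔴 ha₀ hδ₁ hB₁ hmE hmF h

end Record

end Literature.MathematicalPhysics.QuantumFieldTheory.Balaban1983to89.B9Thm315WholeSectERep
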